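import Literature.Geometry.DiscreteGeometry.ShellCensusSearchPhaseTwoB
import HarnessLib

/-!
# Soundness of the census growth search, part E: the search, the roots, the parts

Topic `Literature/Geometry/DiscreteGeometry`.  `search` is sound on realized Phase-1 states (by
the completeness of one growth step, the completeness of closed-up leaves and the soundness of
Phase 2); every frame realizes a root; hence `checkAll = true`, or all parts `checkPart = true`,
give the conclusion `CF.Concl` for every frame.
-/

namespace Literature.Geometry.DiscreteGeometry

namespace ShellCensusSearch

open Finset

/-- **The Phase-1 search is sound**: if it returns `true` on a state realized by a frame, the
frame has the conclusion. [folklore] -/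
theorem search_sound : ∀ (fuel : ℕ) (s : St), s.search fuel = true →
    ∀ (M : CF) (φ : ℕ → Fin 12), Realizes M φ s → M.Concl := by
  intro fuel
  induction fuel with
  | zero => intro s hs; simp [St.search] at hs
  | succ fuel ih =>
    intro s hs M φ h
    unfold St.search at hs
    cases hopen : s.chooseOpen with
    | none =>
      obtain ⟨hn, hsize, -⟩ := h.complete_of_no_open hopen
      have hexp : s.expand = .leaf (if s.tris.size != 20 || s.n != 12 then true else s.bondPhase) := by
        unfold St.expand; rw [hopen]
      rw [hexp] at hs
      simp only [hn, hsize, bne_self_eq_false, Bool.or_self, Bool.false_eq_true, ↓reduceIte] at hs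
      exact bondPhase_sound h hopen hs
    | some pq =>
      obtain ⟨p, q⟩ := pq
      obtain ⟨kids, hexp, s', hs', φ', hR'⟩ := h.expand_branch hopen
      rw [hexp] at hs
      simp only [List.all_eq_true] at hs
      exact ih s' (hs s' hs') M φ' hR'

/-- **Soundness of the whole run**: if every root is searched `true`, every frame has the
conclusion. [folklore] -/
theorem concl_of_checkAll {fuel : ℕ} (h : checkAll fuel = true) (M : CF) : M.Concl := by
  obtain ⟨φ, m0, hm0, hR⟩ := exists_realizes_root M
  unfold checkAll at h
  rw [List.all_eq_true] at h
  have hmem : mkRoot m0 ∈ rootStates := by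
    rcases hm0 with rfl | rfl <;> simp [rootStates]
  exact search_sound fuel _ (h _ hmem) M φ hR

/-- Soundness of one expansion of a list of nodes. [folklore] -/
theorem stepAll_sound : ∀ (L L' : List St) (f : ℕ), stepAll L = some L' →
    (∀ s ∈ L', s.search f = true) → ∀ s ∈ L, s.search (f + 1) = true := by
  intro L
  induction L with
  | nil => intro L' f _ _ s hs; simp at hs
  | cons s0 rest ih =>
    intro L' f hstep hall s hs
    unfold stepAll at hstep
    rw [List.mem_cons] at hs
    split at hstep
    · rename_i hleaf
      rcases hs with rfl | hs
      · unfold St.search; rw [hleaf]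
      · exact ih L' f hstep hall s hs
    · exact absurd hstep (by simp)
    · rename_i kids hbr
      cases hrest : stepAll rest with
      | none => rw [hrest] at hstep; exact absurd hstep (by simp)
      | some L'' =>
        rw [hrest, Option.map_some] at hstep
        have hL' : L' = kids ++ L'' := (Option.some.inj hstep).symm
        rcases hs with rfl | hs
        · unfold St.search; rw [hbr]
          simp only [List.all_eq_true]
          intro s' hs'
          exact hall s' (by rw [hL']; exact List.mem_append_left _ hs')
        · exact ih L'' f hrest (fun s' hs' => hall s' (by rw [hL']; exact List.mem_append_right _ hs')) s hs

/-- Soundness of the frontier. [folklore] -/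
theorem frontier_sound : ∀ (k : ℕ) (L L' : List St) (f : ℕ), frontier L k = some L' →
    (∀ s ∈ L', s.search f = true) → ∀ s ∈ L, s.search (f + k) = true := by
  intro k
  induction k with
  | zero =>
    intro L L' f h hall s hs; unfold frontier at h
    have hL : L = L' := Option.some.inj h
    rw [Nat.add_zero]; exact hall s (hL ▸ hs)
  | succ k ih =>
    intro L L' f h hall s hs
    unfold frontier at h
    split at h
    · exact absurd h (by simp)
    · rename_i L1 hstep
      have := ih L1 L' f h hall
      have h2 := stepAll_sound L L1 (f + k) hstep this s hs
      rwa [show f + (k + 1) = f + k + 1 by ring]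

/-- Members of a list occur in `indexed` with their position. [folklore] -/
theorem mem_indexed_of_mem {α : Type} {L : List α} {x : α} (h : x ∈ L) : ∃ j < L.length, (j, x) ∈ indexed L := by
  unfold indexed
  obtain ⟨j, hj, rfl⟩ := List.getElem_of_mem h
  refine ⟨j, hj, ?_⟩
  rw [List.mem_iff_getElem]
  refine ⟨j, by simpa using hj, ?_⟩
  simp

/-- **Soundness of the run in parts**: if all `parts` parts of the frontier at depth `depth`
return `true`, every frame has the conclusion. [folklore] -/
theorem concl_of_parts {depth parts fuel : ℕ} (hparts : 0 < parts)
    (h : ∀ i, i < parts → checkPart depth parts i fuel = true) (M : CF) : M.Concl := by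
  obtain ⟨φ, m0, hm0, hR⟩ := exists_realizes_root M
  have hmem : mkRoot m0 ∈ rootStates := by
    rcases hm0 with rfl | rfl <;> simp [rootStates]
  cases hfr : frontier rootStates depth with
  | none =>
    have h0 := h 0 hparts
    unfold checkPart at h0
    rw [hfr] at h0
    exact absurd h0 Bool.false_ne_true
  | some L =>
    have hall : ∀ s ∈ L, s.search fuel = true := by
      intro s hs
      obtain ⟨j, -, hj⟩ := mem_indexed_of_mem hs
      have hi := h (j % parts) (Nat.mod_lt _ hparts)
      unfold checkPart at hi
      rw [hfr] at hi
      simp only [List.all_eq_true] at hi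
      have := hi (j, s) hj
      simpa using this
    exact search_sound (fuel + depth) _ (frontier_sound depth rootStates L fuel hfr hall _ hmem) M φ hR

end ShellCensusSearch

end Literature.Geometry.DiscreteGeometry
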